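import Literature.AlgebraicGeometry.HodgeTheory.RationalHodgeClasses
import Literature.AlgebraicGeometry.HodgeTheory.GysinFormalism
import Literature.NumberTheory.Transcendental.AnalytificationFunctorialityProofs
import HarnessLib

/-!
# Transport of rational classes, Hodge types and algebraic classes along isomorphisms of `ℂ`-schemes

Family `hodge`, layer `Literature/AlgebraicGeometry/HodgeTheory`. For an isomorphism
`e : X' ≅ X` of `ℂ`-schemes, `e(ℂ) : X'(ℂ) → X(ℂ)` is a homeomorphism of complex points
(`Motives.AlgPoints.isHomeomorph_map_of_iso`; functoriality of `X ↦ X(ℂ)`, Mumford, Red Book I.10)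
and the pull-back `e^* = complexBetti.map e.hom i : Hⁱ(X(ℂ); ℂ) → Hⁱ(X'(ℂ); ℂ)` is an isomorphism
with inverse `(e⁻¹)^*` (`CategoryTheory.Iso.complexBetti_map_hom_map_inv`, `…_map_inv_map_hom`).
This file PROVES that the three predicates of the Hodge conjecture on the tree's carriers are
INVARIANT under `e^*`, as `iff`s and without any hypothesis on `X`, `X'`:

* `isRationalClass_map_iff_of_iso`: `e^* c` is rational iff `c` is (Hatcher §3.1 p. 198:
  `f^♯ φ = φ ∘ f_♯` has the values of `φ`; the tree's `IsRationalClass.pullback`, file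
  `RationalHodgeClasses`);
* `isOfHodgeType_map_iff_of_iso`: `e^* c` is of Hodge type `(p, q)` on `X'` iff `c` is on `X` — a
  Hodge model `A` of `X` (complex manifold `M`, analytification `φ : M → X(ℂ)`, de Rham comparison,
  Hodge decomposition; `RationalHodgeClasses`) gives the Hodge model of `X'` with the SAME manifold
  and comparison and the analytification `e⁻¹(ℂ) ∘ φ` (`IsAnalytification.transport_iso`: regular
  functions on `X'` pull back along `e` to regular functions on `X`, the tree's
  `AlgPoints.evalOrZero_map`; Serre, GAGA §2, functoriality of `X ↦ X^h`), in which `e^* c` has the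
  pull-back that `c` has in `A`; in particular `Nonempty (HodgeModel n X') ↔ Nonempty (HodgeModel n X)`
  (`nonempty_hodgeModel_iff_of_iso`);
* `mem_supportedClasses_map_iff_of_iso`, `mem_algebraicClasses_map_iff_of_iso`,
  `algebraicClasses_map_eq_of_iso`: `e^*(Nʳ Hⁱ(X)) = Nʳ Hⁱ(X')`, in particular for the algebraic
  classes `Nᵖ H²ᵖ` — restriction to `(X ∖ Z)(ℂ)` commutes with pull-back (Grothendieck, Topology 8
  (1969) §1) and `e` preserves the codimension of points (it is a homeomorphism of the underlying
  spaces, hence an isomorphism of specialisation orders, `coheight_base_eq_of_iso`). No flatness,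
  smoothness or Noetherian hypothesis is needed for an isomorphism.

## Relation to `HodgeTheory/FermatHypersurfaceReduction` (work item `defn-FermatLayerConeLightRehome`)

That file proves the implications `IsOfHodgeType.map_of_iso`, `mem_algebraicClasses_map_of_iso`
(for smooth projective `X`, `X'`, through flat pull-back) and `map_hom_map_inv_apply`, and defines
the transported model `HodgeModel.ofIso`; its import closure carries 14 unproved named facts
(`FermatHodgeConjectureProofs`, `HodgeConjectureQbarVoisinProofs`, `ComplexConjugation`). The
fully-qualified names cannot be re-homed by a single-file proposal while other files use them, so
this light file (imports `RationalHodgeClasses`, `GysinFormalism`, `AnalytificationFunctorialityProofs`;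
no named fact beyond the cone of `Summits/HodgeConjecture/HodgeConjecture/Statement.lean`) states the
hypothesis-free `iff` forms under the names above; the lemmas of `FermatHypersurfaceReduction` are
their corollaries. Four auxiliary statements are byte-equal to heavy-cone lemmas and SUPERSEDE them
(transitional duplicates of the re-home): `CategoryTheory.Iso.complexBetti_map_hom_map_inv` /
`…_map_inv_map_hom` / `complexBetti.bijective_map_of_iso` (= `complexBetti.map_hom_map_inv_apply` /
`map_inv_map_hom_apply` / `map_bijective_of_iso` of `MotivatedClassesTransport`, and
`map_hom_map_inv_apply` of `FermatHypersurfaceReduction`) and `IsAnalytification.transport_iso`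
(= `IsAnalytification.comp_map_iso` of `FermatHypersurfaceReduction`); the follow-up librarian
refactor (work item filed together with this file) re-proves those heavy copies as one-line aliases
of the lemmas here, so that `IsoTransport` holds the surviving proofs.
`Motives.IsSmoothProjective.of_iso` (transport of smooth projectivity) is in `Motives/CurveNet`.

## References

* [SerreGAGA1956] J.-P. Serre, GAGA, Ann. Inst. Fourier 6 (1956), §2 (functoriality of `X ↦ X^h`).
* [GrothendieckTopology1969] A. Grothendieck, Hodge's general conjecture is false for trivial
  reasons, Topology 8 (1969), §1 (the filtration by codimension of support is functorial).
* [HatcherAT2002] A. Hatcher, Algebraic Topology (2002), §3.1 p. 198.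
* [MumfordRedBook1999] D. Mumford, The Red Book of Varieties and Schemes, I.10 (complex points).
-/

noncomputable section

open CategoryTheory AlgebraicGeometry
open Literature.AlgebraicTopology.SingularHomology

universe u

/-! ### `e(L)` for an isomorphism `e` is a homeomorphism -/

namespace Literature.AlgebraicGeometry.Motives.AlgPoints

variable {k : Type u} [Field k] {X Y : SchemeOver k} {L : Type u} [Field L] [Algebra k L]

/-- `e⁻¹(L) (e(L) P) = P`. [folklore] -/
@[simp]
theorem map_inv_map_hom_apply (e : X ≅ Y) (P : AlgPoints X L) : map e.inv (map e.hom P) = P := by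
  rw [← map_comp_apply, Iso.hom_inv_id, map_id_apply]

/-- `e(L) (e⁻¹(L) Q) = Q`. [folklore] -/
@[simp]
theorem map_hom_map_inv_apply (e : X ≅ Y) (Q : AlgPoints Y L) : map e.hom (map e.inv Q) = Q := by
  rw [← map_comp_apply, Iso.inv_hom_id, map_id_apply]

/-- **An isomorphism of `k`-schemes induces a homeomorphism `e(L) : X(L) → Y(L)`** of `L`-points
with their strong topologies (continuous with continuous inverse `e⁻¹(L)`; Mumford, Red Book I.10).
[cite: MumfordRedBook1999, I.10] -/
theorem isHomeomorph_map_of_iso [TopologicalSpace L] (e : X ≅ Y) : IsHomeomorph (map (L := L) e.hom) :=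
  isHomeomorph_iff_exists_inverse.2
    ⟨continuous_map _, map e.inv, map_inv_map_hom_apply e, map_hom_map_inv_apply e, continuous_map _⟩

end Literature.AlgebraicGeometry.Motives.AlgPoints

/-! ### Analytifications transport along isomorphisms -/

namespace Literature.NumberTheory.Transcendental

open Literature.AlgebraicGeometry.Motives

/-- **Analytifications transport along isomorphisms of `ℂ`-schemes**: if `φ : M → X(ℂ)` is an
analytification of `X` and `e : X ≅ X'`, then `e(ℂ) ∘ φ` is an analytification of `X'` — `e(ℂ)` is a
homeomorphism, and a regular function `s` on an affine open `U ⊆ X'` pulls back along `e(ℂ) ∘ φ` to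
the pull-back along `φ` of the regular function `e^* s` on the affine open `e⁻¹U ⊆ X`
(`AlgPoints.evalOrZero_map`). Serre, GAGA §2 (functoriality of `X ↦ X^h`). SUPERSEDES the
byte-equal `IsAnalytification.comp_map_iso` of `HodgeTheory/FermatHypersurfaceReduction` (heavy
import cone); that copy becomes a one-line alias of this lemma in the follow-up librarian refactor
(work item filed with this file), so that the surviving proof is this one. [cite: SerreGAGA1956, §2] -/
theorem IsAnalytification.transport_iso {E : Type*} [NormedAddCommGroup E] [NormedSpace ℂ E]
    [FiniteDimensional ℂ E] {M : Type*} [TopologicalSpace M] [ChartedSpace E M]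
    {X X' : SchemeOver ℂ} {d : ℕ} {φ : M → ComplexPoints X}
    (hφ : IsAnalytification E X d φ) (e : X ≅ X') :
    IsAnalytification E X' d (AlgPoints.map e.hom ∘ φ) where
  isHomeomorph := (AlgPoints.isHomeomorph_map_of_iso (L := ℂ) e).comp hφ.isHomeomorph
  finrank_eq := hφ.finrank_eq
  mdifferentiableOn_evalOrZero U s := by
    let eL : X.left ≅ X'.left := (Over.forget _).mapIso e
    have hU : IsAffineOpen (eL.hom ⁻¹ᵁ (U : X'.left.Opens)) := U.2.preimage_of_isIso eL.hom
    have key := hφ.mdifferentiableOn_evalOrZero ⟨_, hU⟩ (e.hom.left.app (U : X'.left.Opens) s)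
    have hfun : (fun m ↦ AlgPoints.evalOrZero (U : X'.left.Opens) s ((AlgPoints.map e.hom ∘ φ) m)) =
        fun m ↦ AlgPoints.evalOrZero (e.hom.left ⁻¹ᵁ (U : X'.left.Opens))
          (e.hom.left.app (U : X'.left.Opens) s) (φ m) :=
      funext fun m ↦ AlgPoints.evalOrZero_map e.hom (U : X'.left.Opens) s (φ m)
    rw [hfun]
    exact key

end Literature.NumberTheory.Transcendental

/-! ### Codimension of points is invariant under isomorphisms -/

namespace Literature.AlgebraicGeometry.HodgeTheory

/-- **An isomorphism of schemes preserves the codimension of points** (`Order.coheight` in the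
specialisation order `a ≤ b ↔ b ⤳ a`, Mathlib `Scheme.le_iff_specializes`): its underlying map is a
homeomorphism, hence an order isomorphism. [folklore] -/
theorem coheight_base_eq_of_iso {F G : Scheme.{u}} (e : F ≅ G) (x : ↥F) :
    Order.coheight (e.hom.base x) = Order.coheight x := by
  let f : ↥F ≃o ↥G :=
    { toFun := e.hom.base
      invFun := e.inv.base
      left_inv := fun a ↦ by
        change (e.hom ≫ e.inv).base a = a
        rw [e.hom_inv_id]
        rfl
      right_inv := fun b ↦ by
        change (e.inv ≫ e.hom).base b = b
        rw [e.inv_hom_id]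
        rfl
      map_rel_iff' := fun {a b} ↦ by
        change e.hom.base a ≤ e.hom.base b ↔ a ≤ b
        rw [Scheme.le_iff_specializes, Scheme.le_iff_specializes]
        exact e.hom.isOpenEmbedding.toIsEmbedding.toIsInducing.specializes_iff }
  exact Order.coheight_orderIso f x

/-- The same for `k`-schemes: `codim (e x) = codim x` for `e : X ≅ X'` over `k`. [folklore] -/
theorem coheight_left_base_eq_of_iso {k : Type u} [Field k] {X X' : Motives.SchemeOver k} (e : X ≅ X')
    (x : ↥X.left) : Order.coheight (e.hom.left.base x) = Order.coheight x :=
  coheight_base_eq_of_iso ((Over.forget _).mapIso e) x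

section HodgeTheory

variable {n : ℕ} {X X' : Motives.SchemeOver ℂ}

/-! ### `e^*` is invertible -/

/-- `e^* ((e⁻¹)^* c') = c'` on `Hⁱ(X'(ℂ); ℂ)` for `e : X' ≅ X` (dot notation on Mathlib's
`CategoryTheory.Iso`, a deliberate extension). SUPERSEDES the byte-equal
`complexBetti.map_hom_map_inv_apply` of `HodgeTheory/MotivatedClassesTransport` and
`map_hom_map_inv_apply` of `HodgeTheory/FermatHypersurfaceReduction` (heavy import cones); those
copies become one-line aliases of this lemma in the follow-up librarian refactor (work item filed
with this file). [folklore] -/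
@[simp]
theorem _root_.CategoryTheory.Iso.complexBetti_map_hom_map_inv (e : X' ≅ X) (i : ℕ)
    (c' : complexBetti X' i) : complexBetti.map e.hom i (complexBetti.map e.inv i c') = c' := by
  rw [← CategoryTheory.comp_apply, ← complexBetti.map_comp, e.hom_inv_id, complexBetti.map_id]
  rfl

/-- `(e⁻¹)^* (e^* c) = c` on `Hⁱ(X(ℂ); ℂ)` for `e : X' ≅ X` (dot notation on Mathlib's
`CategoryTheory.Iso`, a deliberate extension). SUPERSEDES the byte-equal
`complexBetti.map_inv_map_hom_apply` of `HodgeTheory/MotivatedClassesTransport` (heavy import cone);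
that copy becomes a one-line alias of this lemma in the follow-up librarian refactor (work item
filed with this file). [folklore] -/
@[simp]
theorem _root_.CategoryTheory.Iso.complexBetti_map_inv_map_hom (e : X' ≅ X) (i : ℕ)
    (c : complexBetti X i) : complexBetti.map e.inv i (complexBetti.map e.hom i c) = c := by
  rw [← CategoryTheory.comp_apply, ← complexBetti.map_comp, e.inv_hom_id, complexBetti.map_id]
  rfl

/-- `e^* : Hⁱ(X(ℂ); ℂ) → Hⁱ(X'(ℂ); ℂ)` is bijective for an isomorphism `e : X' ≅ X`. SUPERSEDES the
byte-equal `complexBetti.map_bijective_of_iso` of `HodgeTheory/MotivatedClassesTransport` (heavy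
import cone); that copy becomes a one-line alias of this lemma in the follow-up librarian refactor
(work item filed with this file). [folklore] -/
theorem complexBetti.bijective_map_of_iso (e : X' ≅ X) (i : ℕ) :
    Function.Bijective (complexBetti.map e.hom i) :=
  ⟨fun a b h ↦ by simpa using congrArg (complexBetti.map e.inv i) h,
    fun c' ↦ ⟨complexBetti.map e.inv i c', e.complexBetti_map_hom_map_inv i c'⟩⟩

/-! ### Rational classes -/

/-- **Along an isomorphism a class is rational iff its pull-back is.** [cite: HatcherAT2002, §3.1 p. 198] -/
theorem isRationalClass_map_iff_of_iso (e : X' ≅ X) {k : ℕ} {c : complexBetti X k} :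
    IsRationalClass (complexBetti.map e.hom k c) ↔ IsRationalClass c := by
  refine ⟨fun h ↦ ?_, IsRationalClass.pullback _⟩
  have h' := IsRationalClass.pullback (Motives.AlgPoints.mapContinuous (L := ℂ) e.inv) h
  rwa [← complexBetti.map, e.complexBetti_map_inv_map_hom] at h'

/-! ### Hodge types -/

/-- **Hodge types transport along isomorphisms**: if `e^* c'` is of Hodge type `(p, q)` on `X`
(witnessed by a Hodge model `A` of `X`, analytification `φ : M → X(ℂ)`), then `c'` is of Hodge type
`(p, q)` on `X'`, witnessed by the model of `X'` with the same manifold, comparison and Hodge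
decomposition and the analytification `e(ℂ) ∘ φ` (`IsAnalytification.transport_iso`), whose
pull-back of `c'` IS the pull-back of `e^* c'` in `A`. [cite: SerreGAGA1956, §2]
[cite: VoisinHodgeI2002, §7.1.1] -/
theorem IsOfHodgeType.of_map_iso (e : X ≅ X') {k p q : ℕ} {c' : complexBetti X' k}
    (h : IsOfHodgeType n X k p q (complexBetti.map e.hom k c')) : IsOfHodgeType n X' k p q c' := by
  obtain ⟨A, hA⟩ := h
  let A' : HodgeModel n X' :=
    { A with
      toComplexPoints := Motives.AlgPoints.map e.hom ∘ A.toComplexPoints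
      isAnalytification := A.isAnalytification.transport_iso e }
  refine ⟨A', ?_⟩
  have hc : (⟨A'.toComplexPoints, A'.isAnalytification.isHomeomorph.continuous⟩ :
        C(A.carrier, Motives.ComplexPoints X')) =
      (Motives.AlgPoints.mapContinuous (L := ℂ) e.hom).comp
        ⟨A.toComplexPoints, A.isAnalytification.isHomeomorph.continuous⟩ :=
    ContinuousMap.ext fun _ ↦ rfl
  change singularCohomology.map ℂ ℂ
      (⟨A'.toComplexPoints, A'.isAnalytification.isHomeomorph.continuous⟩ :
        C(A.carrier, Motives.ComplexPoints X')) k c' ∈ A.hodgePQ k p q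
  rw [hc, singularCohomology.map_comp]
  exact hA

/-- **Along an isomorphism `e : X' ≅ X`, `e^* c` is of Hodge type `(p, q)` on `X'` iff `c` is on
`X`.** (The forward implication for `c` is `IsOfHodgeType.of_map_iso`; the backward one is it for
`e⁻¹` and `e^* c`, as `(e⁻¹)^* e^* c = c`.) [cite: SerreGAGA1956, §2] [cite: VoisinHodgeI2002, §7.1.1] -/
theorem isOfHodgeType_map_iff_of_iso (e : X' ≅ X) {k p q : ℕ} {c : complexBetti X k} :
    IsOfHodgeType n X' k p q (complexBetti.map e.hom k c) ↔ IsOfHodgeType n X k p q c := by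
  refine ⟨fun h ↦ IsOfHodgeType.of_map_iso e h, fun h ↦ IsOfHodgeType.of_map_iso e.symm ?_⟩
  rwa [Iso.symm_hom, e.complexBetti_map_inv_map_hom]

/-- **Hodge models transport along isomorphisms**: `X'` has a Hodge model iff `X` has, for
`e : X' ≅ X` (same manifold, comparison and decomposition; analytification composed with `e(ℂ)`).
[cite: SerreGAGA1956, §2] -/
theorem nonempty_hodgeModel_iff_of_iso (e : X' ≅ X) : Nonempty (HodgeModel n X') ↔ Nonempty (HodgeModel n X) :=
  ⟨fun ⟨A⟩ ↦ ⟨{ A with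
      toComplexPoints := Motives.AlgPoints.map e.hom ∘ A.toComplexPoints
      isAnalytification := A.isAnalytification.transport_iso e }⟩,
    fun ⟨A⟩ ↦ ⟨{ A with
      toComplexPoints := Motives.AlgPoints.map e.inv ∘ A.toComplexPoints
      isAnalytification := A.isAnalytification.transport_iso e.symm }⟩⟩

/-! ### Supported and algebraic classes -/

/-- **Pull-back along an isomorphism respects the support filtration**: `e^*(Nʳ Hⁱ(X)) ⊆ Nʳ Hⁱ(X')`
for `e : X' ≅ X` — a class vanishing on `(X ∖ Z)(ℂ)`, `Z` Zariski-closed of codimension `≥ r`,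
pulls back to a class vanishing on `(X' ∖ e⁻¹Z)(ℂ)` (restriction commutes with pull-back), and
`e⁻¹Z` is closed of codimension `≥ r` (`coheight_left_base_eq_of_iso`). [cite: GrothendieckTopology1969, §1] -/
theorem mem_supportedClasses_map_of_iso (e : X' ≅ X) {i r : ℕ} {x : complexBetti X i}
    (hx : x ∈ supportedClasses X i r) : complexBetti.map e.hom i x ∈ supportedClasses X' i r := by
  suffices h : supportedClasses X i r ≤ (supportedClasses X' i r).comap (complexBetti.map e.hom i).hom from
    h hx
  refine iSup_le fun Z ↦ iSup_le fun hZ ↦ iSup_le fun hr ↦ fun z hz ↦ ?_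
  rw [LinearMap.mem_ker] at hz
  refine mem_supportedClasses_of_restrictCompl_eq_zero (Z := e.hom.left.base ⁻¹' Z)
    (hZ.preimage e.hom.left.base.hom.continuous)
    (fun w hw ↦ (hr _ hw).trans (coheight_left_base_eq_of_iso e w).le) ?_
  -- restriction to the complements commutes with pull-back along `e(ℂ)`
  let g : C(Motives.complexPointsCompl X' (e.hom.left.base ⁻¹' Z), Motives.complexPointsCompl X Z) :=
    ⟨fun P ↦ ⟨Motives.AlgPoints.mapContinuous (L := ℂ) e.hom P.1, fun hP ↦ P.2 hP⟩, by fun_prop⟩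
  have hcomm : complexBetti.map e.hom i ≫ complexBetti.restrictCompl X' (e.hom.left.base ⁻¹' Z) i =
      complexBetti.restrictCompl X Z i ≫ singularCohomology.map ℂ ℂ g i := by
    rw [complexBetti.restrictCompl, complexBetti.restrictCompl, complexBetti.map,
      ← singularCohomology.map_comp, ← singularCohomology.map_comp]
    rfl
  change (complexBetti.map e.hom i ≫ complexBetti.restrictCompl X' (e.hom.left.base ⁻¹' Z) i) z = 0
  rw [hcomm, CategoryTheory.comp_apply]
  change singularCohomology.map ℂ ℂ g i (complexBetti.restrictCompl X Z i z) = 0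
  rw [hz, map_zero]

/-- **`e^* x ∈ Nʳ Hⁱ(X') ↔ x ∈ Nʳ Hⁱ(X)`** for an isomorphism `e : X' ≅ X`. [cite: GrothendieckTopology1969, §1] -/
theorem mem_supportedClasses_map_iff_of_iso (e : X' ≅ X) {i r : ℕ} {x : complexBetti X i} :
    complexBetti.map e.hom i x ∈ supportedClasses X' i r ↔ x ∈ supportedClasses X i r := by
  refine ⟨fun h ↦ ?_, mem_supportedClasses_map_of_iso e⟩
  have h' := mem_supportedClasses_map_of_iso e.symm h
  rwa [Iso.symm_hom, e.complexBetti_map_inv_map_hom] at h'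

/-- **`e^*(Nʳ Hⁱ(X)) = Nʳ Hⁱ(X')`** for an isomorphism `e : X' ≅ X`. [cite: GrothendieckTopology1969, §1] -/
theorem supportedClasses_map_eq_of_iso (e : X' ≅ X) (i r : ℕ) :
    (supportedClasses X i r).map (complexBetti.map e.hom i).hom = supportedClasses X' i r := by
  refine le_antisymm (Submodule.map_le_iff_le_comap.2 fun x hx ↦ mem_supportedClasses_map_of_iso e hx)
    fun x' hx' ↦ ⟨complexBetti.map e.inv i x', ?_, e.complexBetti_map_hom_map_inv i x'⟩
  exact (mem_supportedClasses_map_iff_of_iso e).1 (by rwa [e.complexBetti_map_hom_map_inv])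

/-- **Algebraic classes transport along isomorphisms**: `e^* c ∈ algebraicClasses X' p ↔
c ∈ algebraicClasses X p` for `e : X' ≅ X` — no smoothness or flatness hypothesis (compare
`mem_algebraicClasses_map_of_iso` of `FermatHypersurfaceReduction` and the tree's
`map_mem_algebraicClasses_of_flat`). [cite: GrothendieckTopology1969, §1] -/
theorem mem_algebraicClasses_map_iff_of_iso (e : X' ≅ X) {p : ℕ} {c : complexBetti X (2 * p)} :
    complexBetti.map e.hom (2 * p) c ∈ algebraicClasses X' p ↔ c ∈ algebraicClasses X p :=
  mem_supportedClasses_map_iff_of_iso e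

/-- `e^*(algebraicClasses X p) = algebraicClasses X' p` for an isomorphism `e : X' ≅ X`.
[cite: GrothendieckTopology1969, §1] -/
theorem algebraicClasses_map_eq_of_iso (e : X' ≅ X) (p : ℕ) :
    (algebraicClasses X p).map (complexBetti.map e.hom (2 * p)).hom = algebraicClasses X' p :=
  supportedClasses_map_eq_of_iso e (2 * p) p

/-! ### The Hodge conjecture, cycle part, is invariant under isomorphism -/

/-- **The three predicates at once**: for `e : X' ≅ X`, every rational class of Hodge type `(p, p)`
in `H²ᵖ(X(ℂ); ℂ)` is algebraic iff the same holds on `X'` (each of rationality, Hodge type and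
algebraicity is invariant under the bijection `e^*`). [cite: GrothendieckTopology1969, §1]
[cite: SerreGAGA1956, §2] -/
theorem forall_hodgeClass_mem_algebraicClasses_iff_of_iso (e : X' ≅ X) (p : ℕ) :
    (∀ c' : complexBetti X' (2 * p), IsRationalClass c' → IsOfHodgeType n X' (2 * p) p p c' →
        c' ∈ algebraicClasses X' p) ↔
      ∀ c : complexBetti X (2 * p), IsRationalClass c → IsOfHodgeType n X (2 * p) p p c →
        c ∈ algebraicClasses X p := by
  constructor
  · intro h c hc hpp
    rw [← mem_algebraicClasses_map_iff_of_iso e]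
    exact h _ ((isRationalClass_map_iff_of_iso e).2 hc) ((isOfHodgeType_map_iff_of_iso e).2 hpp)
  · intro h c' hc' hpp'
    rw [← mem_algebraicClasses_map_iff_of_iso e.symm]
    exact h _ ((isRationalClass_map_iff_of_iso e.symm).2 hc') ((isOfHodgeType_map_iff_of_iso e.symm).2 hpp')

end HodgeTheory

end Literature.AlgebraicGeometry.HodgeTheory

end
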